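import Summits.QuantumFields.QCD.Theses.NestedDissectionSea

/-!
# Sketch (crux-ideate, ideator 2, round 1) — first lemmas for the two idea cards on
# `NestedDissectionSea.NegativeCellsDilute` (stmt-QuantumFields-13900)

Card A `mass-wegner-cell-index`  : `HasNearKernel`, `SojournOfCrossing`, `SojournOfDefect`,
                                   `NearKernelStripLaw` (the transfer C⁺ for clause (a)).
Card B `sign-mobility-identity`  : `SignMobilityIdentity`, `MobilityBound`, `pqMeasure`, `PinOfMobility`
                                   (the transfer C⁺ for clause (b)).
Statements only (`def … : Prop`); nothing here is an item.
-/

noncomputable section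

namespace Summit.QuantumFields.QCD.Cruxes.NegativeCellsDilute.Ideator2

open scoped BigOperators ENNReal Classical
open MeasureTheory ProbabilityTheory
open Literature.MathematicalPhysics.QuantumLattice Literature.MathematicalPhysics.QuantumFieldTheory
  Literature.Probability.LatticeModels

/-- Local notation: the colour group `SU(3)`. -/
local notation "𝔾" => Matrix.specialUnitaryGroup (Fin 3) ℂ

/-! ## Card A — reverse Wegner estimate in the bare mass -/

/-- The Dirichlet cell `(x, s)` at bare mass `μ'` has a NEAR-KERNEL at level `η`: some non-zero vector
has residual below `η` times its norm (`σ_min (wilsonCell U μ' x s) < η`). Same style as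
`HasSingularSeparator`. -/
def HasNearKernel {N : ℕ} [NeZero N] (U : GaugeConfig 4 N 𝔾) (μ' : ℝ) (x : TorusSite 4 N)
    (s : Fin 4 → ℕ) (η : ℝ) : Prop :=
  ∃ v : {p // wilsonBox x s p} → ℂ, v ≠ 0 ∧
    ∑ p, ‖(wilsonCell U μ' x s).mulVec v p‖ ^ 2 < η ^ 2 * ∑ p, ‖v p‖ ^ 2

/-- SOJOURN OF A CROSSING (exact, provable now, size S): a zero mode of the cell at `μ₀` is an
`η`-near-kernel vector at every bare mass within `η` of `μ₀`, because the mass is a scalar shift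
(`wilsonDirac_mass_eq_add_scalar` restricted): `(W + μ') v = (μ' − μ₀) v`. This is the kernel of the
"reverse Wegner estimate in the mass": the conjugate of the bare mass is the identity on the cell
(and `Γ₅` on the Hermitian side), of norm one. -/
def SojournOfCrossing : Prop :=
  ∀ (N : ℕ) [NeZero N] (U : GaugeConfig 4 N 𝔾) (x : TorusSite 4 N) (s : Fin 4 → ℕ) (μ₀ η μ' : ℝ),
    (wilsonCell U μ₀ x s).det = 0 → |μ' - μ₀| < η → HasNearKernel U μ' x s η

/-- SOJOURN OF A DEFECT (provable now from `SignDefectForcesCrossing` + `KineticEdge` +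
`SojournOfCrossing`): a sign defect of the corner-`0` box at scale `j` and valence mass `μ` produces a
crossing mass `μ₀ ∈ [μ, 0]` of the parent or of one of the sixteen children, around which that cell is
`η`-near-singular on the whole interval `(μ₀ − η, μ₀ + η)` — an interval of bare masses of length `2η`
inside the supercritical strip `[μ − η, η]`. -/
def SojournOfDefect : Prop :=
  ∀ (N : ℕ) [NeZero N] (U : GaugeConfig 4 N 𝔾) (μ : ℝ) (j : ℕ) (s : Fin 4 → ℕ) (η : ℝ),
    0 < η → (∀ i, s i ≤ N) → IsSignDefect U μ j s →
      ∃ μ₀ : ℝ, μ ≤ μ₀ ∧ μ₀ ≤ 0 ∧ ∀ μ' : ℝ, |μ' - μ₀| < η →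
        (HasNearKernel U μ' 0 s η ∨
          ∃ ε : Fin 4 → Bool, HasNearKernel U μ' (halfCorner s ε) (halfSides s ε) η)

/-- THE TRANSFER C⁺ FOR CLAUSE (a) — WINDOWED INTEGRATED NEAR-KERNEL LAW (a linear spectral statistic
of the Dirichlet cells across the supercritical strip, replacing the parity event). Same prefix as the
crux; for every `ε`, eventually in `k`, on every odd torus of physical side `≥ R`, there are a level
`η > 0` and `δ ≥ 0` with `Σ_j δ_j ≤ ε` such that for every window box at scale `j`:
`(2η)⁻¹ Σ_f ∫_{m_f(k) − η}^{η} P(parent or a child is η-near-singular at μ') dμ' ≤ δ_j` (lower Lebesgue integral of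
the `[0,1]`-valued probability, so no Bochner junk-zero for a non-measurable integrand; it is finite, `≤` the strip length).
By `SojournOfDefect` + Fubini/Markov, C⁺ implies clause (a) of `NegativeCellsDilute` with the same `δ`. -/
def NearKernelStripLaw : Prop :=
  ∀ Nf : ℕ, (Nf = 2 ∨ Nf = 3) → ∃ reg : QCDRegularisation Nf, reg.HasMassScaling ∧
    (reg.scheme 0 0 0).HasAsymptoticScaling ∧ ∃ M₀ : ℝ, 0 ≤ M₀ ∧ ∃ b₀ : ℕ, 2 ≤ b₀ ∧ ∃ ℓ : ℝ, 0 < ℓ ∧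
    ∀ m : Fin Nf → ℝ, (∀ f, M₀ < m f) → ∃ R : ℝ, 0 < R ∧
    ∀ ε : ℝ, 0 < ε → ∀ᶠ k : ℕ in Filter.atTop, ∀ S : ℕ, R ≤ reg.a k * (2 * S + 1) →
      let N : ℕ := 2 * S + 1
      let mq : Fin Nf → ℝ := fun f => reg.mcrit k + reg.a k * m f / reg.Zm k
      let wt : GaugeConfig 4 N 𝔾 → ℝ :=
        fun U => ∏ f, ‖fermionDet (wilsonDirac (fundamentalRep (Fin 3)) U (mq f) 1)‖
      let P : (GaugeConfig 4 N 𝔾 → Prop) → ℝ := fun E =>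
        (∫ U, (if E U then (1 : ℝ) else 0) * wt U
            ∂(wilsonMeasure (d := 4) (L := N) (fundamentalRep (Fin 3)) (reg.β k))) /
          (∫ U, wt U ∂(wilsonMeasure (d := 4) (L := N) (fundamentalRep (Fin 3)) (reg.β k)))
      let J : ℕ := Nat.log 2 (⌊ℓ / reg.a k⌋₊ / b₀) + 1
      ∃ η : ℝ, 0 < η ∧ ∃ δ : ℕ → ℝ, (∀ j, 0 ≤ δ j) ∧ ∑ j ∈ Finset.range J, δ j ≤ ε ∧
        ∀ j < J, ∀ s : Fin 4 → ℕ,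
          (∀ i, b₀ * 2 ^ j ≤ s i ∧ s i < b₀ * 2 ^ (j + 2) ∧ s i ≤ N ∧ (s i : ℝ) * reg.a k ≤ ℓ) →
          (2 * η)⁻¹ * ∑ f, (∫⁻ μ' in Set.Icc (mq f - η) η,
              ENNReal.ofReal (P (fun U => HasNearKernel U μ' 0 s η ∨
                ∃ c : Fin 4 → Bool, HasNearKernel U μ' (halfCorner s c) (halfSides s c) η))).toReal ≤ δ j

/-! ## Card B — the sign–mobility identity -/

/-- SIGN–MOBILITY IDENTITY (provable now, pure measure theory, size S–M): for every Markov kernel `κ`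
leaving a probability measure `μ` invariant and every `±1`-valued observable `σ`,
`E_μ[σ · m_κ] = 0` where `m_κ(ω) = κ(ω){σ flips}` is the one-step sign-flip probability.
Proof: `∫ κσ dμ = ∫ σ dμ` (invariance) and `(κσ)(ω) = σ(ω)(1 − 2 m_κ(ω))`. -/
def SignMobilityIdentity : Prop :=
  ∀ (Ω : Type) [MeasurableSpace Ω] (μ : Measure Ω) [IsProbabilityMeasure μ] (κ : Kernel Ω Ω)
    [IsMarkovKernel κ] (σ : Ω → ℝ), Measurable σ → (∀ ω, σ ω = 1 ∨ σ ω = -1) → μ.bind κ = μ →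
    ∫ ω, σ ω * (κ ω {ω' | σ ω' ≠ σ ω}).toReal ∂μ = 0

/-- MOBILITY BOUND (corollary, provable now): under the same hypotheses, for every constant `c > 0`,
`|E_μ σ| ≤ E_μ|m_κ − c| / c`; in particular a 50%-concentration of the flip rate (`E|m_κ − c| ≤ c/2`)
gives `P(σ = −1) ≥ 1/4`. -/
def MobilityBound : Prop :=
  ∀ (Ω : Type) [MeasurableSpace Ω] (μ : Measure Ω) [IsProbabilityMeasure μ] (κ : Kernel Ω Ω)
    [IsMarkovKernel κ] (σ : Ω → ℝ), Measurable σ → (∀ ω, σ ω = 1 ∨ σ ω = -1) → μ.bind κ = μ →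
    ∀ c : ℝ, 0 < c →
      |∫ ω, σ ω ∂μ| ≤ (∫ ω, |(κ ω {ω' | σ ω' ≠ σ ω}).toReal - c| ∂μ) / c

/-- The normalised PHASE-QUENCHED probability measure on `SU(3)` gauge fields of the torus of side `N`
at inverse coupling `β` and bare valence masses `mq` (the `P` of the crux as a measure). -/
def pqMeasure (N : ℕ) [NeZero N] (β : ℝ) {Nf : ℕ} (mq : Fin Nf → ℝ) : Measure (GaugeConfig 4 N 𝔾) :=
  let wt : GaugeConfig 4 N 𝔾 → ℝ :=
    fun U => ∏ f, ‖fermionDet (wilsonDirac (fundamentalRep (Fin 3)) U (mq f) 1)‖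
  let ν := (wilsonMeasure (d := 4) (L := N) (fundamentalRep (Fin 3)) β).withDensity
    fun U => ENNReal.ofReal (wt U)
  (ν Set.univ)⁻¹ • ν

/-- THE TRANSFER C⁺ FOR CLAUSE (b) — PIN FROM MOBILITY CONCENTRATION: if SOME dynamics `κ` leaving the
phase-quenched measure invariant has a sign-flip rate (for the sign of `Re det D_W` at the probe mass
`μp`) concentrated within 50% of a constant `c > 0`, then the determinant is negative with probability
`≥ 1/4`. Pure consequence of `MobilityBound` (the normalisation hypothesis `IsProbabilityMeasure pqMeasure` is a
true, provable side fact — `wt` is continuous, bounded and positive off a null variety — made explicit so that the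
zero-measure junk case cannot falsify the implication); the physics is in exhibiting `κ` (the random-scan block Gibbs
sampler) whose flip rate is a spatial average of block propensities. -/
def PinOfMobility : Prop :=
  ∀ (N : ℕ) [NeZero N] (β : ℝ) (Nf : ℕ) (mq : Fin Nf → ℝ) (μp : ℝ)
    (κ : Kernel (GaugeConfig 4 N 𝔾) (GaugeConfig 4 N 𝔾)) [IsMarkovKernel κ] (c : ℝ), 0 < c →
    IsProbabilityMeasure (pqMeasure N β mq) →
    (pqMeasure N β mq).bind κ = pqMeasure N β mq →
    let σ : GaugeConfig 4 N 𝔾 → ℝ :=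
      fun U => if (fermionDet (wilsonDirac (fundamentalRep (Fin 3)) U μp 1)).re < 0 then -1 else 1
    (∫ U, |(κ U {V | σ V ≠ σ U}).toReal - c| ∂(pqMeasure N β mq)) ≤ c / 2 →
      (1 / 4 : ℝ) ≤ ((pqMeasure N β mq) {U | σ U = -1}).toReal

end Summit.QuantumFields.QCD.Cruxes.NegativeCellsDilute.Ideator2

end
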